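import Summits.ABC.IUTFork.Thm311RealInd1StripBaseLineOdd
import Summits.ABC.IUTFork.Thm311RealInd1StripBaseUnits
import HarnessLib

/-!
# [IUTchIII] Thm 3.11 (i) (Ind1) at `v ∈ 𝕍^non`, ODD local degree — UNIT LEVEL: Kondo's Lemma 2.5 (2) («THE lift carries the `p`-adic units
# `ℤ_p^× ⊆ 𝒪_v^×` off themselves modulo torsion») OR the residual branch, modulo `JannsenWingbergTwists`

PROOF-ONLY file (abc-iut cell, Cor. 3.12 sub-crew, seat abc-iut-c312-1 = holder of record of the typed [IUTchIII] Thm. 3.11,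
gen 13; row «R15 ODD-DEGREE BASE LINE», part c).  TAKES NO SIDE on [IUTchIII] Cor. 3.12.

Gen 12 (`Thm311RealInd1StripBaseUnits`, p505187) put Kondo's Lemma 2.5 (2) («the intersection `φ^×(𝒪^×_{k^{(d=1)}}) ∩ 𝒪^×_{k^{(d=1)}}` is not
open», arXiv:2512.09231; Hoshi, Kodai Math. J. 47 (2024) Lemma 3.1 (v) at `d_k = 2`) in the kernel at every `v ∣ p` odd of EVEN local degree,
modulo `JannsenWingbergTwistsFirst`, at the level print's (Ind1) speaks about — the units `𝒪_v^× = O^×(G_v)^{G_v}` and THE equivariant lift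
`Real.liftUnits v φ` ([AbsTopIII] Prop. 3.2 (iv), gen 8 p448652).  For ODD local degree `≥ 3` print leaves the base-line question OPEN (Kondo
p. 5 and Remark p. 12; part b `Thm311RealInd1StripBaseLineOdd` makes it a DICHOTOMY decided by one bit).  This file is the unit-level reading
of that dichotomy:
* **`Real.exists_liftUnits_padic_inter_padic_subset_torsion_or_residual_of_jannsenWingberg_odd`** — assume `JannsenWingbergTwists`; at every
  `v ∣ p` odd with `[K_v : ℚ_p] ≥ 3` ODD: EITHER there is `φ ∈ Aut_top(G_v)` such that every `u ∈ 𝒪_v^×` with `log u` AND `log(liftUnits φ u)` both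
  `p`-adic is TORSION (`liftUnits φ (μ·ℤ_p^×) ∩ μ·ℤ_p^× ⊆ μ` — Kondo's Lemma 2.5 (2) shape), OR the residual branch of part b holds (a realised
  Jannsen–Wingberg basis `y : Fin 1 ⊕ Fin g × Fin 2` with all `2g` plane transvections in `Real.ind1StripOf v (Real.galoisLog v)`,
  `span(planes) = Ker(Tr)`, and `1 ∈ ℚ_p·y_{inl 0}`);
* **`Real.liftUnits_uZero_not_mem_or_residual_of_jannsenWingberg_odd`** — in the first branch THE lift carries the `p`-adic unit `u₀ = 1 + p_v`
  (gen 8 `Real.uZero`) to a unit that is NOT torsion × `p`-adic: `liftUnits φ u₀ ≠ ζ·w`;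
* `Real.liftUnits_eq_mul_torsion_of_fixes_baseLine` — conversely, in the residual branch the realised twists FIX the `p`-adic units modulo
  torsion: if `φ` realises a `ψ` fixing `ℚ_p·1` pointwise then for every `p`-adic `u`, `(liftUnits φ u)^n = u^n` for some `n > 0`.
HONEST SCOPE: conditional on `JannsenWingbergTwists` (binder displayed); which branch holds is not pinned by print (Kondo, loc. cit.); other
elements of `Aut(G_v)` than the realised twists are not excluded from moving `μ·ℤ_p^×` in the residual branch; nothing here asserts or refutes
[IUTchIII] Cor. 3.12; NO abc claim.  [claim: Mochizuki2012, status: disputed]; [cite: Kondo2025OuterAutMLF, §1 p.5, §2 Lemma 2.5 (2), Remark p.12];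
[cite: Hoshi2024IntrinsicHodgeTate, Lemma 3.1 (v) pp.10–11]; [cite: HoshiNishio2022OuterAutMLF, Lemma 2.4, Rmk 2.5 p.8];
[cite: MochizukiAbsTopIII2015, Prop 3.2 (iv)].  typed ≠ proved; a conditional theorem discharges nothing it binds.
-/

set_option autoImplicit false

noncomputable section

open Metric Set
open scoped Pointwise

namespace Summit.ABC.IUTFork.Thm311.Real

open NumberField IsDedekindDomain Literature.NumberTheory.NumberFields Literature.IUT.LogVolume
open Literature.NumberTheory.GaloisRepresentations
open Literature.AnabelianGeometry.AbsoluteAnabelian Literature.IUT.HodgeArakelov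
open Literature.IUT.HodgeArakelov.AbsTopMonoids

variable {F : Type} [Field F] [NumberField F] (v : HeightOneSpectrum (𝓞 F))

/-! ## 1. A realised automorphism fixing the base line fixes the `p`-adic units modulo torsion -/

/-- **Residual behaviour at the unit level**: if `φ ∈ Aut_top(G_v)` realises (through the Galois logarithm) an automorphism `ψ` of `K_v` fixing
the base line pointwise — `ψ(a·1) = a·1` for all `a ∈ ℚ_p` — then THE equivariant lift of `φ` FIXES every `p`-adic unit modulo torsion:
`log(liftUnits φ u) = ψ(log u) = log u` (a `p`-adic unit has a `p`-adic logarithm, gen 12), hence `(liftUnits φ u)^n = u^n` for some `n > 0`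
(gen 8 `exists_pow_eq_of_galoisLog_eq`). [claim: Mochizuki2012, status: disputed] [cite: MochizukiAbsTopIII2015, Prop 3.2 (iv)] -/
theorem liftUnits_eq_mul_torsion_of_fixes_baseLine (p : ℕ) [Fact p.Prime] (hv : ((p : ℕ) : 𝓞 F) ∈ v.asIdeal)
    [Fact (closureAt v).residueChar.Prime]
    {φ : Gal v ≃ₜ* Gal v} {ψ : v.adicCompletion F ≃+ v.adicCompletion F} (hφ : Realises v (galoisLog v) (stripMulAut v φ) ψ)
    (hfix : ∀ a : ℚ_[p],
      RescaledCompletion.of F p v hv (ψ ((RescaledCompletion.of F p v hv).symm (algebraMap ℚ_[p] (RescaledCompletion F p v hv) a))) =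
        algebraMap ℚ_[p] (RescaledCompletion F p v hv) a)
    (u : (↥(v.adicCompletionIntegers F))ˣ)
    (hu : RescaledCompletion.of F p v hv (((u : ↥(v.adicCompletionIntegers F)) : v.adicCompletion F)) ∈
      Set.range (algebraMap ℚ_[p] (RescaledCompletion F p v hv))) :
    ∃ n : ℕ, 0 < n ∧ liftUnits v φ u ^ n = u ^ n := by
  rw [realises_stripMulAut_iff] at hφ
  obtain ⟨a, ha⟩ := of_galoisLog_mem_range_of_mem_range v p hv u hu
  -- `log u = a·1` read back in `K_v`
  have hlog : galoisLog v (Additive.ofMul u) =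
      (RescaledCompletion.of F p v hv).symm (algebraMap ℚ_[p] (RescaledCompletion F p v hv) a) := by
    rw [ha, RingEquiv.symm_apply_apply]
  -- `log(liftUnits φ u) = ψ(log u) = ψ(a·1) = a·1 = log u`
  have h : galoisLog v (Additive.ofMul (liftUnits v φ u)) = galoisLog v (Additive.ofMul u) := by
    apply (RescaledCompletion.of F p v hv).injective
    rw [← hφ u, hlog, hfix a, RingEquiv.apply_symm_apply]
  exact exists_pow_eq_of_galoisLog_eq v h

/-! ## 2. Kondo's Lemma 2.5 (2) shape OR the residual branch, at odd local degree -/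

/-- **KONDO'S LEMMA 2.5 (2) SHAPE AT THE REAL LOG-SHELL, OR THE RESIDUAL BRANCH — odd local degree, modulo `JannsenWingbergTwists`.**  At every
finite place `v ∣ p` of a number field with `p` odd and `[K_v : ℚ_p] ≥ 3` ODD: EITHER there is a topological automorphism `φ` of `G_v` such that,
for THE equivariant lift `liftUnits v φ` on `𝒪_v^×`, every unit whose logarithm AND whose image's logarithm are both `p`-adic is TORSION —
`liftUnits φ (μ·ℤ_p^×) ∩ μ·ℤ_p^× ⊆ μ`, «`φ^×(𝒪^×_{k^{(d=1)}}) ∩ 𝒪^×_{k^{(d=1)}}` is not open» —, OR the residual branch of part b: a realised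
Jannsen–Wingberg basis `y : Fin 1 ⊕ Fin g × Fin 2` of `K_v^{(1/n_v)}`, all `2g` plane transvections in `Real.ind1StripOf v (Real.galoisLog v)`,
`span(planes) = Ker(Tr)`, with `1 ∈ ℚ_p·y_{inl 0}`.  Proof of the first branch as at even degree: `φ` realises a strip automorphism `χ` with
`χ(a·1) ∉ ℚ_p·1` (`a ≠ 0`) through `log`.  Print does not pin the branch (Kondo p. 5, Remark p. 12).
[claim: Mochizuki2012, status: disputed] [cite: Kondo2025OuterAutMLF, §1 p.5, §2 Lemma 2.5 (2), Remark p.12]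
[cite: Hoshi2024IntrinsicHodgeTate, Lemma 3.1 (v) pp.10–11] -/
theorem exists_liftUnits_padic_inter_padic_subset_torsion_or_residual_of_jannsenWingberg_odd (hJW : JannsenWingbergTwists)
    (p : ℕ) [Fact p.Prime] (hv : ((p : ℕ) : 𝓞 F) ∈ v.asIdeal) (hp2 : p ≠ 2) (h3 : 3 ≤ localDeg F v) (hodd : Odd (localDeg F v)) :
    (∃ φ : Gal v ≃ₜ* Gal v, ∀ u : (↥(v.adicCompletionIntegers F))ˣ,
      RescaledCompletion.of F p v hv (galoisLog v (Additive.ofMul u)) ∈ Set.range (algebraMap ℚ_[p] (RescaledCompletion F p v hv)) →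
      RescaledCompletion.of F p v hv (galoisLog v (Additive.ofMul (liftUnits v φ u))) ∈
        Set.range (algebraMap ℚ_[p] (RescaledCompletion F p v hv)) →
      IsOfFinOrder u) ∨
    (∃ (g : ℕ) (_ : localDeg F v = 1 + 2 * g) (y : Module.Basis (Fin 1 ⊕ Fin g × Fin 2) ℚ_[p] (RescaledCompletion F p v hv))
      (ψ ψ' : Fin g → (v.adicCompletion F ≃+ v.adicCompletion F)),
      (∀ i, ψ i ∈ ind1StripOf v (galoisLog v)) ∧ (∀ i, ψ' i ∈ ind1StripOf v (galoisLog v)) ∧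
      (∀ i (x : RescaledCompletion F p v hv),
        RescaledCompletion.of F p v hv (ψ i ((RescaledCompletion.of F p v hv).symm x)) =
          x + y.coord (Sum.inr (i, 1)) x • y (Sum.inr (i, 0))) ∧
      (∀ i (x : RescaledCompletion F p v hv),
        RescaledCompletion.of F p v hv (ψ' i ((RescaledCompletion.of F p v hv).symm x)) =
          x - y.coord (Sum.inr (i, 0)) x • y (Sum.inr (i, 1))) ∧
      Submodule.span ℚ_[p] (Set.range fun iε : Fin g × Fin 2 => y (Sum.inr iε)) =
        LinearMap.ker (Algebra.trace ℚ_[p] (RescaledCompletion F p v hv)) ∧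
      (1 : RescaledCompletion F p v hv) ∈ ℚ_[p] ∙ y (Sum.inl 0)) := by
  haveI : Fact (closureAt v).residueChar.Prime := (closureAt v).fact_residueChar_prime
  obtain ⟨g, hcard, y, ψ, ψ', hψ, hψ', hT, hT', hspan, -, hdich⟩ := baseLine_dichotomy_of_jannsenWingberg_odd v hJW p hv hp2 h3 hodd
  rcases hdich with ⟨-, χ, hχ, hmove⟩ | ⟨hmem, -⟩
  · left
    obtain ⟨-, -, φ, hφ⟩ := hχ
    rw [realises_stripMulAut_iff] at hφ
    refine ⟨φ, fun u hu hlift => ?_⟩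
    obtain ⟨a, ha⟩ := hu
    by_cases ha0 : a = 0
    · -- `log u = 0`
      apply isOfFinOrder_of_galoisLog_eq_zero v u
      apply (RescaledCompletion.of F p v hv).injective
      rw [← ha, ha0, map_zero, map_zero]
    · -- `log u = a·1`, `a ≠ 0`: `χ(a·1) = log(liftUnits φ u)` would be `p`-adic
      exfalso
      refine hmove a ha0 ?_
      rw [ha, RingEquiv.symm_apply_apply, hφ u]
      exact hlift
  · exact Or.inr ⟨g, hcard, y, ψ, ψ', hψ, hψ', hT, hT', hspan, hmem⟩

/-- **THE LIFT CARRIES `1 + p_v` OFF `μ·ℤ_p^×`, OR THE RESIDUAL BRANCH** — odd local degree, modulo `JannsenWingbergTwists`: at every `v ∣ p` odd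
with `[K_v : ℚ_p] ≥ 3` ODD, EITHER some `φ ∈ Aut_top(G_v)` has `liftUnits v φ u₀ ≠ ζ·w` for EVERY torsion `ζ ∈ 𝒪_v^×` and every `p`-adic unit `w`,
where `u₀ = 1 + p_v ∈ ℤ_p^×` (gen 8 `Real.uZero`; concrete form of Kondo's Lemma 2.5 (2) / Hoshi's Lemma 3.1 (v)), OR the residual branch of part b
holds.  [claim: Mochizuki2012, status: disputed] [cite: Kondo2025OuterAutMLF, §2 Lemma 2.5 (2), Remark p.12]
[cite: Hoshi2024IntrinsicHodgeTate, Lemma 3.1 (v) pp.10–11] -/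
theorem liftUnits_uZero_not_mem_or_residual_of_jannsenWingberg_odd (hJW : JannsenWingbergTwists) [Fact (closureAt v).residueChar.Prime]
    (hp2 : (closureAt v).residueChar ≠ 2) (h3 : 3 ≤ localDeg F v) (hodd : Odd (localDeg F v)) :
    (∃ φ : Gal v ≃ₜ* Gal v, ∀ ζ w : (↥(v.adicCompletionIntegers F))ˣ, IsOfFinOrder ζ →
      RescaledCompletion.of F (closureAt v).residueChar v (natCast_residueChar_closureAt_mem v)
          (((w : ↥(v.adicCompletionIntegers F)) : v.adicCompletion F)) ∈
        Set.range (algebraMap ℚ_[(closureAt v).residueChar]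
          (RescaledCompletion F (closureAt v).residueChar v (natCast_residueChar_closureAt_mem v))) →
      liftUnits v φ (uZero v) ≠ ζ * w) ∨
    (∃ (g : ℕ) (_ : localDeg F v = 1 + 2 * g)
      (y : Module.Basis (Fin 1 ⊕ Fin g × Fin 2) ℚ_[(closureAt v).residueChar]
        (RescaledCompletion F (closureAt v).residueChar v (natCast_residueChar_closureAt_mem v)))
      (ψ ψ' : Fin g → (v.adicCompletion F ≃+ v.adicCompletion F)),
      (∀ i, ψ i ∈ ind1StripOf v (galoisLog v)) ∧ (∀ i, ψ' i ∈ ind1StripOf v (galoisLog v)) ∧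
      (∀ i (x : RescaledCompletion F (closureAt v).residueChar v (natCast_residueChar_closureAt_mem v)),
        RescaledCompletion.of F (closureAt v).residueChar v (natCast_residueChar_closureAt_mem v)
            (ψ i ((RescaledCompletion.of F (closureAt v).residueChar v (natCast_residueChar_closureAt_mem v)).symm x)) =
          x + y.coord (Sum.inr (i, 1)) x • y (Sum.inr (i, 0))) ∧
      (∀ i (x : RescaledCompletion F (closureAt v).residueChar v (natCast_residueChar_closureAt_mem v)),
        RescaledCompletion.of F (closureAt v).residueChar v (natCast_residueChar_closureAt_mem v)
            (ψ' i ((RescaledCompletion.of F (closureAt v).residueChar v (natCast_residueChar_closureAt_mem v)).symm x)) =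
          x - y.coord (Sum.inr (i, 0)) x • y (Sum.inr (i, 1))) ∧
      Submodule.span ℚ_[(closureAt v).residueChar] (Set.range fun iε : Fin g × Fin 2 => y (Sum.inr iε)) =
        LinearMap.ker (Algebra.trace ℚ_[(closureAt v).residueChar]
          (RescaledCompletion F (closureAt v).residueChar v (natCast_residueChar_closureAt_mem v))) ∧
      (1 : RescaledCompletion F (closureAt v).residueChar v (natCast_residueChar_closureAt_mem v)) ∈
        ℚ_[(closureAt v).residueChar] ∙ y (Sum.inl 0)) := by
  set hv := natCast_residueChar_closureAt_mem v
  rcases exists_liftUnits_padic_inter_padic_subset_torsion_or_residual_of_jannsenWingberg_odd v hJW (closureAt v).residueChar hv hp2 h3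
      hodd with ⟨φ, hφ⟩ | hres
  · refine Or.inl ⟨φ, fun ζ w hζ hw heq => not_isOfFinOrder_uZero v (hφ (uZero v) ?_ ?_)⟩
    · exact of_galoisLog_mem_range_of_mem_range v (closureAt v).residueChar hv (uZero v) ⟨_, (of_coe_uZero v).symm⟩
    · rw [heq]
      exact of_galoisLog_mul_mem_range_of_isOfFinOrder v (closureAt v).residueChar hv ζ w hζ hw
  · exact Or.inr hres

/-- **In the residual branch the realised twists fix the `p`-adic units modulo torsion** (the unit-level reading of «every realised plane twist
fixes `ℚ_p·1` pointwise», part b): for the data of `baseLine_dichotomy_of_jannsenWingberg_odd` in its second branch, every `φ ∈ Aut_top(G_v)`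
realising one of the `ψ i`, `ψ' i` satisfies `(liftUnits φ u)^n = u^n`, `n > 0`, for every `p`-adic unit `u`.  Recorded as the generic
implication (§1) applied to the pointwise-fixing clause. [claim: Mochizuki2012, status: disputed] [cite: Kondo2025OuterAutMLF, Remark p.12]
[cite: MochizukiAbsTopIII2015, Prop 3.2 (iv)] -/
theorem liftUnits_pow_eq_of_residual (p : ℕ) [Fact p.Prime] (hv : ((p : ℕ) : 𝓞 F) ∈ v.asIdeal) [Fact (closureAt v).residueChar.Prime]
    {g : ℕ} {ψ ψ' : Fin g → (v.adicCompletion F ≃+ v.adicCompletion F)}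
    (hfix : ∀ i (a : ℚ_[p]),
      RescaledCompletion.of F p v hv (ψ i ((RescaledCompletion.of F p v hv).symm
          (algebraMap ℚ_[p] (RescaledCompletion F p v hv) a))) = algebraMap ℚ_[p] (RescaledCompletion F p v hv) a ∧
      RescaledCompletion.of F p v hv (ψ' i ((RescaledCompletion.of F p v hv).symm
          (algebraMap ℚ_[p] (RescaledCompletion F p v hv) a))) = algebraMap ℚ_[p] (RescaledCompletion F p v hv) a)
    (i : Fin g) {φ φ' : Gal v ≃ₜ* Gal v}
    (hφ : Realises v (galoisLog v) (stripMulAut v φ) (ψ i)) (hφ' : Realises v (galoisLog v) (stripMulAut v φ') (ψ' i))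
    (u : (↥(v.adicCompletionIntegers F))ˣ)
    (hu : RescaledCompletion.of F p v hv (((u : ↥(v.adicCompletionIntegers F)) : v.adicCompletion F)) ∈
      Set.range (algebraMap ℚ_[p] (RescaledCompletion F p v hv))) :
    (∃ n : ℕ, 0 < n ∧ liftUnits v φ u ^ n = u ^ n) ∧ (∃ n : ℕ, 0 < n ∧ liftUnits v φ' u ^ n = u ^ n) := by
  exact ⟨liftUnits_eq_mul_torsion_of_fixes_baseLine v p hv hφ (fun a => (hfix i a).1) u hu,
    liftUnits_eq_mul_torsion_of_fixes_baseLine v p hv hφ' (fun a => (hfix i a).2) u hu⟩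

end Summit.ABC.IUTFork.Thm311.Real

end
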